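import Literature.AnabelianGeometry.SemiGraphs.FiniteEtaleCoveringDictionary
import Literature.AnabelianGeometry.Anabelioids.FiniteEtaleLocalDictionary
import Literature.AnabelianGeometry.Anabelioids.OverStarReflectsIso
import Literature.AnabelianGeometry.Anabelioids.OverStarExact
import HarnessLib

/-!
# The finite étale covering dictionary ([SemiAnbd] §2) — PROOFS, part 4: (D4) injective type

Mochizuki, *Semi-graphs of anabelioids*, Publ. RIMS **42** (2006) 221–322, §2 Def. 2.1 p. 22 ("of
injective type": every `b_*` induces an injection on fundamental groups), Def. 2.2 (i) p. 23, and
the IMPLICIT use on pp. 29–30 (Prop. 2.6 applied to a finite étale covering of `𝒢`)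
[cite: MochizukiSemiAnbd2006, Def. 2.1 p.22].  abc-iut cell, layer L3, DISCHARGE-L3 §G row G30
(L3-lead, 2026-08-25; this part abc-iut-L4-t17): `covering_isOfInjectiveType_holds` discharges the
named fact (D4) `SemiGraphOfAnabelioids.covering_isOfInjectiveType` of
`FiniteEtaleCoveringDictionary.lean` AS TYPED.

Proof.  For a branch `b′` of `e′` abutting to `v′` over `b`, `e`, `v`, t1's morphisms carry the 2-cell
`φ_b : φ_{v′}^* ⋙ b′^* ≅ b^* ⋙ φ_{e′}^*` (`Hom.φB`).  For a basepoint `F` of `𝒢′_{e′}`: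
`π₁(b^* ⋙ φ_{e′}^*) = π₁(b^*) ∘ π₁(φ_{e′}^*)` is injective — `φ_{e′}^*` is finite étale (edge clause of
`IsFiniteEtaleCoveringOf`), hence a `π₁`-monomorphism (abc-iut-L6-t17 `isPi1Mono_of_isFiniteEtale`),
and `b^*` is a `π₁`-monomorphism at the basepoint `φ_{e′}^* ⋙ F`, which IS a basepoint by the (d0)
glue (L6-t17 `nonempty_fiberFunctor_of_iso_star_comp'` + abc-iut-L3-t5 `preservesFiniteColimits_overStar`,
assembled here as `nonempty_fiberFunctor_of_iso_star_comp_of_isConnected`); isomorphic composites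
have conjugate `π₁` (`autMulEquivOfIso_pi1Map_of_sq`), so `π₁(φ_{v′}^* ⋙ b′^*) = π₁(φ_{v′}^*) ∘ π₁(b′^*)`
is injective, whence `π₁(b′^*)` is.  Nothing here takes a side on [IUTchIII] Cor. 3.12; typed ≠ discharged.
-/

namespace Literature.AnabelianGeometry

open CategoryTheory CategoryTheory.Limits CategoryTheory.Functor CategoryTheory.PreGaloisCategory

universe w v u₁ u₂ u₃ u₄

namespace Anabelioids

/-! ### (d0) glue, unconditional: the basepoint induced along a finite étale pull-back -/

section Glue

variable {C : Type u₁} [Category.{u₂} C] [GaloisCategory C]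
  {D : Type u₃} [Category.{u₂} D] [GaloisCategory D]

/-- **`Q ⋙ F` is a basepoint** for a finite étale pull-back `Q ≅ (S × −) ⋙ α` with `S` connected and a
basepoint `F` — UNCONDITIONAL form of abc-iut-L6-t17's `nonempty_fiberFunctor_of_iso_star_comp'`: its
colimit-exactness hypotheses on `Over.star S` are discharged by abc-iut-L3-t5's
`preservesFiniteColimits_overStar` ([GeoAn] Def. 1.1.2 (ii) p. 10: "`φ` induces a basepoint `φ ∘ β`").
[cite: MochizukiGeoAn2004, Def. 1.1.2(ii) p.10] -/
theorem nonempty_fiberFunctor_of_iso_star_comp_of_isConnected (S : C) [IsConnected S]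
    (α : Over S ⥤ D) [α.IsEquivalence] {Q : C ⥤ D} (e : Q ≅ Over.star S ⋙ α)
    (F : D ⥤ FintypeCat.{u₂}) [FiberFunctor F] : Nonempty (FiberFunctor (Q ⋙ F)) := by
  haveI : PreservesFiniteColimits (Over.star S) := preservesFiniteColimits_overStar S
  have hq : ∀ (G : Type u₂) [Group G] [Finite G], PreservesColimitsOfShape (SingleObj G) (Over.star S) := by
    intro G _ _
    obtain ⟨G', _, _, ⟨e'⟩⟩ := Finite.exists_type_univ_nonempty_mulEquiv.{u₂, 0} G
    letI : Fintype G' := Fintype.ofFinite G'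
    haveI : PreservesColimitsOfShape (SingleObj G') (Over.star S) :=
      PreservesFiniteColimits.preservesFiniteColimits _
    exact Limits.preservesColimitsOfShape_of_equiv e'.toSingleObjEquiv.symm _
  exact nonempty_fiberFunctor_of_iso_star_comp' S α e F (hq := hq)

end Glue

/-! ### `π₁` of isomorphic composites

(`π₁` of a composite is the composite by `rfl`, cf. `pi1Map_comp_apply` of
`ApproximatorImageProofs`.) -/

section Pi1

variable {V : Type u₁} [Category.{v} V] {V' : Type u₂} [Category.{v} V']
  {E : Type u₃} [Category.{v} E] {E' : Type u₄} [Category.{v} E']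

/-- Along a 2-cell `γ : Q ⋙ P′ ≅ P ⋙ R`, the homomorphisms `π₁(Q ⋙ P′)_F` and `π₁(P ⋙ R)_F` are
conjugate by the induced isomorphism of basepoints `Aut (Q ⋙ P′ ⋙ F) ≃* Aut (P ⋙ R ⋙ F)`
([SemiAnbd] Rem. 2.4.2 p. 26; the computation of abc-iut-L6-t17's `map_map_range_pi1Map_eq_of_sq`).
[cite: MochizukiSemiAnbd2006, Rem. 2.4.2 p.26] -/
theorem autMulEquivOfIso_pi1Map_of_sq (Q : V ⥤ V') (R : E ⥤ E') (P : V ⥤ E) (P' : V' ⥤ E')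
    (γ : Q ⋙ P' ≅ P ⋙ R) (F : E' ⥤ FintypeCat.{w}) (σ : Aut F) :
    (Aut.autMulEquivOfIso (isoWhiskerRight γ F) : Aut (Q ⋙ P' ⋙ F) ≃* Aut (P ⋙ R ⋙ F))
        (pi1Map (Q ⋙ P') F σ) = pi1Map (P ⋙ R) F σ := by
  refine Iso.ext (NatTrans.ext (funext fun A => ?_))
  show F.map (γ.inv.app A) ≫ σ.hom.app (P'.obj (Q.obj A)) ≫ F.map (γ.hom.app A) =
    σ.hom.app (R.obj (P.obj A))
  have nat' : σ.hom.app (P'.obj (Q.obj A)) ≫ F.map (γ.hom.app A) =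
      F.map (γ.hom.app A) ≫ σ.hom.app (R.obj (P.obj A)) := (σ.hom.naturality (γ.hom.app A)).symm
  exact (congrArg (fun k => F.map (γ.inv.app A) ≫ k) nat').trans
    ((F.mapIso (γ.app A)).inv_hom_id_assoc _)

/-- Hence `π₁(Q ⋙ P′)_F` is injective iff `π₁(P ⋙ R)_F` is. [cite: MochizukiSemiAnbd2006, Rem. 2.4.2 p.26] -/
theorem injective_pi1Map_iff_of_sq (Q : V ⥤ V') (R : E ⥤ E') (P : V ⥤ E) (P' : V' ⥤ E')
    (γ : Q ⋙ P' ≅ P ⋙ R) (F : E' ⥤ FintypeCat.{w}) :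
    Function.Injective (pi1Map (Q ⋙ P') F) ↔ Function.Injective (pi1Map (P ⋙ R) F) := by
  have key : (pi1Map (P ⋙ R) F : Aut F → Aut (P ⋙ R ⋙ F)) =
      (Aut.autMulEquivOfIso (isoWhiskerRight γ F) : Aut (Q ⋙ P' ⋙ F) ≃* Aut (P ⋙ R ⋙ F)) ∘
        (pi1Map (Q ⋙ P') F) :=
    funext fun σ => (autMulEquivOfIso_pi1Map_of_sq Q R P P' γ F σ).symm
  rw [key]
  exact ((Aut.autMulEquivOfIso (isoWhiskerRight γ F)).injective.of_comp_iff _).symm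

end Pi1

end Anabelioids

namespace SemiGraphs

open Literature.AnabelianGeometry.Anabelioids

universe v₁ w₁ uu

namespace SemiGraphOfAnabelioids

/-- The edge components `φ_{e′} : 𝒢′_{e′} → 𝒢_f` of the finite étale covering attached to `A` are
finite étale onto a CONNECTED component of `T_f`, for every presentation `f`, `p : φ(e′) = f` of the
target edge (transport of the edge clause of `IsFiniteEtaleCoveringOf` along `p`).
[cite: MochizukiSemiAnbd2006, Def. 2.2(i) p.23] -/
theorem exists_iso_star_comp_φE {𝒢 𝒢' : SemiGraphOfAnabelioids.{v₁, w₁, uu}} (φ : Hom 𝒢' 𝒢)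
    (A : 𝒢.BObj) (hφ : φ.IsFiniteEtaleCoveringOf A) (e' : 𝒢'.graph.Edge) (f : 𝒢.graph.Edge)
    (p : φ.base.edgeMap e' = f) :
    ∃ (S : 𝒢.E f) (_ : PreGaloisCategory.IsConnected S) (α : Over S ⥤ 𝒢'.E e') (_ : α.IsEquivalence),
      Nonempty ((φ.φE e' f p).pullback ≅ Over.star S ⋙ α) := by
  subst p
  obtain ⟨_, _, cE, _, _, _, hE, _⟩ := hφ
  obtain ⟨α, hα, hiso⟩ := hE e'
  exact ⟨_, (cE e').2, α, hα, hiso⟩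

/-- **(D4) DISCHARGED: a finite étale covering of a semi-graph of anabelioids of injective type is of
injective type** ([SemiAnbd] Def. 2.1 p. 22; implicit on pp. 29–30).  See the module docstring for the
proof. [cite: MochizukiSemiAnbd2006, Prop. 2.6 p.29] -/
theorem covering_isOfInjectiveType_holds : covering_isOfInjectiveType.{v₁, w₁, uu} := by
  intro 𝒢 𝒢' φ A _ hφ hinj
  refine ⟨fun b' v' h' => ?_⟩
  intro F _
  -- the square of pull-back functors and its 2-cell
  let Q := (φ.φV v').pullback
  let P' := (𝒢'.pull b' v' h').pullback
  let P := (𝒢.pull (φ.base.branchMap b') (φ.base.vertexMap v') (φ.base.abuts_branchMap b' v' h')).pullback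
  let R := (φ.φE (𝒢'.graph.edgeOf b') (𝒢.graph.edgeOf (φ.base.branchMap b'))
    (φ.base.edgeOf_branchMap b').symm).pullback
  let γ : Q ⋙ P' ≅ P ⋙ R := φ.φB b' v' h'
  -- `R = φ_{e′}^*` is finite étale onto a connected component
  obtain ⟨S, hS, α, hα, ⟨eR⟩⟩ :=
    exists_iso_star_comp_φE φ A hφ (𝒢'.graph.edgeOf b') _ (φ.base.edgeOf_branchMap b').symm
  -- the induced basepoint `R ⋙ F` of `𝒢_e`
  haveI : PreGaloisCategory.IsConnected S := hS
  haveI : α.IsEquivalence := hα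
  obtain ⟨hFF⟩ := nonempty_fiberFunctor_of_iso_star_comp_of_isConnected S α eR F
  -- `π₁(R)` injective (finite étale ⇒ π₁-mono) and `π₁(P)` injective at `R ⋙ F` (injective type)
  have hR : Function.Injective (pi1Map R F) := isPi1Mono_of_isFiniteEtale ⟨S, α, hα, ⟨eR⟩⟩ F
  have hP : Function.Injective (pi1Map P (R ⋙ F)) := hinj.isPi1Mono _ _ _ (R ⋙ F)
  have hPR : Function.Injective (pi1Map (P ⋙ R) F) := by
    have : (pi1Map (P ⋙ R) F : Aut F → Aut ((P ⋙ R) ⋙ F)) =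
        (pi1Map P (R ⋙ F)) ∘ (pi1Map R F) := funext fun _ => rfl
    rw [this]
    exact hP.comp hR
  -- transport along `γ`, then cancel the first factor `π₁(Q)`
  have hQP' : Function.Injective (pi1Map (Q ⋙ P') F) := (injective_pi1Map_iff_of_sq Q R P P' γ F).2 hPR
  have : (pi1Map (Q ⋙ P') F : Aut F → Aut ((Q ⋙ P') ⋙ F)) =
      (pi1Map Q (P' ⋙ F)) ∘ (pi1Map P' F) := funext fun _ => rfl
  rw [this] at hQP'
  exact hQP'.of_comp

end SemiGraphOfAnabelioids

end SemiGraphs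

end Literature.AnabelianGeometry
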